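import Summits.CriticalPhenomena.PercolationContinuityZ3.Theorems.SahiMasterFamilySaturation

/-!
# The sandwich structure of `Z_3` and slot bookkeeping for order four

Companion of `SahiMasterFamilySupport.lean` / `SahiMasterFamilySaturation.lean` (unit `prim-master-conj`, crux anchor stmt-CriticalPhenomena-4575).
Preparation for the order-four step of the master conjecture (`SahiMasterFamilyFourStep.lean`): for increasing
events, `(X, Y, G) ∈ Z_3` via the pair `(X, Y)` (`ZVia X Y G`) forces the **sandwich**
`X ∩ K ⊆ G`, `Y ∩ K ⊆ G`, `G ⊆ K` for the *forced-open hull* `K = {ω | ω ∪ (esupp X ∪ esupp Y) ∈ G}`, an increasing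
event on which no coordinate of `esupp X ∪ esupp Y` acts (`sandwich_left`, `sandwich_right`, `subset_forcedHull`,
`not_affects_forcedHull`); hence `X ∩ G = X ∩ K`, `Y ∩ G = Y ∩ K` with `K` independent of `X`, `Y` and `X ∩ Y`.
Also: moving a slot of `E_n` to the front (`sahiE_eq_cons_succAbove`, from the symmetry `sahiE_comp_perm`), the
order-four reindexing `sahiE_four_reindex`, `Z_3` from a `ZVia` at three named positions
(`suppZeroFlag_three_of_zVia_at`), and two support lemmas (`esupp_inter_subset`, `esupp_subset_esupp_inter`).
Everything here is proved; axioms standard. [this work]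
-/

noncomputable section

open scoped Classical

namespace Summit.CriticalPhenomena.PercolationContinuityZ3.Theorems

open Finset Function
open Literature.Combinatorics.Sahi2008
open Literature.Probability.Percolation (DeterminedBy determinedBy_iff)
open Literature.Probability.LatticeModels.Kahn2022 (Affects)

/-! ### Slot bookkeeping -/

section Reindex

variable {α : Type*} [Fintype α]

/-- **Moving slot `i` to the front**: `E_{n+2}(F) = E_{n+2}(F_i, F_{−i})` (symmetry of `E_n`). [this work] -/
theorem sahiE_eq_cons_succAbove (μ : α → ℝ) (n : ℕ) (F : Fin (n + 2) → α → ℝ) (i : Fin (n + 2)) :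
    sahiE μ (n + 2) F =
      sahiE μ (n + 2) (Fin.cons (F i) (fun j => F (i.succAbove j)) : Fin (n + 2) → α → ℝ) := by
  have hF : F = fun j =>
      (Fin.cons (F i) (fun j => F (i.succAbove j)) : Fin (n + 2) → α → ℝ) (i.cycleRange j) := by
    funext j
    rw [Fin.cons_apply_cycleRange]
    exact (congrFun (Fin.insertNth_self_removeNth i F) j).symm
  conv_lhs => rw [hF]
  rw [sahiE_comp_perm]

/-- **Order-four reindexing**: for a slot `m : Fin 4` and a slot `i : Fin 3` of the deleted family `F_{−m}`,
`E_4(F) = E_4(F_{−m} i, F m, F_{−m} (i.succAbove 0), F_{−m} (i.succAbove 1))`. [this work] -/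
theorem sahiE_four_reindex (μ : α → ℝ) (F : Fin 4 → α → ℝ) (m : Fin 4) (i : Fin 3) :
    sahiE μ 4 F = sahiE μ 4 ![F (m.succAbove i), F m, F (m.succAbove (i.succAbove 0)),
      F (m.succAbove (i.succAbove 1))] := by
  rw [sahiE_eq_cons_succAbove μ 2 F m,
    sahiE_eq_cons_succAbove μ 2 (Fin.cons (F m) (fun j => F (m.succAbove j)) : Fin 4 → α → ℝ) i.succ]
  congr 1
  funext j
  refine Fin.cases ?_ (fun k => ?_) j
  · simp only [Fin.cons_zero, Fin.cons_succ, Matrix.cons_val_zero]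
  · simp only [Fin.cons_succ, Matrix.cons_val_succ]
    refine Fin.cases ?_ (fun k' => ?_) k
    · simp only [Fin.succ_succAbove_zero, Fin.cons_zero, Matrix.cons_val_zero]
    · simp only [Fin.succ_succAbove_succ, Fin.cons_succ, Matrix.cons_val_succ]
      refine Fin.cases ?_ (fun k'' => ?_) k'
      · simp only [Matrix.cons_val_zero]
      · simp only [Matrix.cons_val_succ, Fin.eq_zero k'', Matrix.cons_val_fin_one]
        rfl

end Reindex

/-! ### `Z_3` from `ZVia` at named positions -/

section ZAt

variable {ι : Type*} [Fintype ι]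

omit [Fintype ι] in
/-- `Z_2` is symmetric. [folklore] -/
theorem suppZeroFlag_two_symm {X Y : Set (Set ι)} (h : SuppZeroFlag 2 ![X, Y]) : SuppZeroFlag 2 ![Y, X] := by
  obtain ⟨S, T, hST, hS, hT⟩ := h
  exact ⟨T, S, hST.symm, hT, hS⟩

omit [Fintype ι] in
/-- `ZVia` is symmetric in the independent pair. [this work] -/
theorem zVia_symm {X Y G : Set (Set ι)} (h : ZVia X Y G) : ZVia Y X G := by
  obtain ⟨h1, h2, h3⟩ := h
  refine ⟨suppZeroFlag_two_symm h1, ?_, ?_⟩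
  · exact suppZeroFlag_two_symm h3
  · exact suppZeroFlag_two_symm h2

omit [Fintype ι] in
/-- The two slots other than `c : Fin 3` are `c.succAbove 0` and `c.succAbove 1`, in some order. [folklore] -/
theorem fin_three_succAbove_cases (a b c : Fin 3) (hab : a ≠ b) (hac : a ≠ c) (hbc : b ≠ c) :
    (a = c.succAbove 0 ∧ b = c.succAbove 1) ∨ (a = c.succAbove 1 ∧ b = c.succAbove 0) := by
  fin_cases a <;> fin_cases b <;> fin_cases c <;> simp_all (config := { decide := true })

omit [Fintype ι] in
/-- Every slot of `Fin 3` is `c`, `c.succAbove 0` or `c.succAbove 1`. [folklore] -/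
theorem fin_three_eq_or_succAbove (l c : Fin 3) : l = c ∨ l = c.succAbove 0 ∨ l = c.succAbove 1 := by
  fin_cases l <;> fin_cases c <;> simp (config := { decide := true })

omit [Fintype ι] in
/-- **`Z_3` from `ZVia` at three named positions**: if `ZVia (V a) (V b) (V c)` for three distinct slots then
`V ∈ Z_3` (peel slot `c`). [this work] -/
theorem suppZeroFlag_three_of_zVia_at (V : Fin 3 → Set (Set ι)) (a b c : Fin 3) (hab : a ≠ b) (hac : a ≠ c)
    (hbc : b ≠ c) (h : ZVia (V a) (V b) (V c)) : SuppZeroFlag 3 V := by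
  rw [suppZeroFlag_three_iff_exists]
  refine ⟨c, ?_⟩
  rcases fin_three_succAbove_cases a b c hab hac hbc with ⟨ha, hb⟩ | ⟨ha, hb⟩
  · rw [← ha, ← hb]; exact h
  · rw [← ha, ← hb]; exact zVia_symm h

end ZAt

/-! ### Two support lemmas -/

section Esupp

variable {ι : Type*} [Fintype ι]

/-- The essential support of an intersection lies in the union of the essential supports. [folklore] -/
theorem esupp_inter_subset (A B : Set (Set ι)) : esupp (A ∩ B) ⊆ esupp A ∪ esupp B := by
  intro i hi
  rw [mem_union, mem_esupp, mem_esupp]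
  exact affects_inter_imp (mem_esupp.1 hi)

/-- If the increasing event `A` ignores the coordinates of the nonempty increasing event `Y`, then every coordinate
acting on `A` acts on `A ∩ Y` (lift a pivotal configuration by opening `esupp Y`). [this work] -/
theorem esupp_subset_esupp_inter {A Y : Set (Set ι)} (hA : IsUpperSet A) (hY : IsUpperSet Y) (hYne : Y.Nonempty)
    (hAY : Disjoint (esupp A) (esupp Y)) : esupp A ⊆ esupp (A ∩ Y) := by
  intro e he
  rw [mem_esupp] at he ⊢
  obtain ⟨ω, hω, heω⟩ := he
  refine ⟨ω ∪ ↑(esupp Y), ?_, ?_⟩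
  · intro h
    apply hω
    refine (mem_iff_of_inter_esupp_eq hA ?_).1 h.1
    ext j
    simp only [Set.mem_inter_iff, Set.mem_union, mem_coe]
    constructor
    · rintro ⟨hj | hj, hjA⟩
      · exact ⟨hj, hjA⟩
      · exact absurd hjA (Finset.disjoint_right.1 hAY hj)
    · rintro ⟨hj, hjA⟩
      exact ⟨Or.inl hj, hjA⟩
  · refine ⟨hA ?_ heω, ?_⟩
    · exact Set.insert_subset_insert Set.subset_union_left
    · refine (mem_iff_of_inter_esupp_eq hY ?_).2 (univ_mem_of_nonempty hY hYne)
      ext j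
      simp only [Set.mem_inter_iff, Set.mem_insert_iff, Set.mem_union, mem_coe, Set.mem_univ, true_and]
      constructor
      · rintro ⟨-, hj⟩; exact hj
      · intro hj; exact ⟨Or.inr (Or.inr hj), hj⟩

end Esupp

/-! ### The forced-open hull and the sandwich -/

section Sandwich

variable {ι : Type*} [Fintype ι]

omit [Fintype ι] in
/-- Opening every coordinate of a finite set inside an increasing event, one coordinate at a time: if no single
insertion of a coordinate of `T` moves a configuration of `X` into `G`, then neither does inserting all of `T`.
[this work] -/
theorem union_notMem_of_forall_insert {X G : Set (Set ι)} (hX : IsUpperSet X) (T : Finset ι)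
    (hP : ∀ t ∈ T, ∀ ω ∈ X, ω ∉ G → insert t ω ∉ G) : ∀ ω ∈ X, ω ∉ G → ω ∪ ↑T ∉ G := by
  induction T using Finset.induction_on with
  | empty => intro ω _ hω; simpa using hω
  | insert t T htT ih =>
    intro ω hωX hωG
    have h1 : ω ∪ ↑T ∉ G := ih (fun s hs => hP s (mem_insert_of_mem hs)) ω hωX hωG
    have h2 : insert t (ω ∪ ↑T) ∉ G :=
      hP t (mem_insert_self t T) (ω ∪ ↑T) (hX Set.subset_union_left hωX) h1
    rwa [coe_insert, Set.union_insert]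

omit [Fintype ι] in
/-- The forced-open hull `{ω | ω ∪ S ∈ G}` of an increasing event is increasing. [folklore] -/
theorem isUpperSet_forcedHull {G : Set (Set ι)} (hG : IsUpperSet G) (S : Set ι) :
    IsUpperSet {ω : Set ι | ω ∪ S ∈ G} := fun _ _ hle h =>
  hG (Set.union_subset_union_left S hle) h

omit [Fintype ι] in
/-- An increasing event lies in its forced-open hull. [folklore] -/
theorem subset_forcedHull {G : Set (Set ι)} (hG : IsUpperSet G) (S : Set ι) : G ⊆ {ω : Set ι | ω ∪ S ∈ G} :=
  fun _ h => hG Set.subset_union_left h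

omit [Fintype ι] in
/-- No coordinate of `S` acts on the forced-open hull `{ω | ω ∪ S ∈ G}`. [folklore] -/
theorem not_affects_forcedHull (G : Set (Set ι)) {S : Set ι} {i : ι} (hi : i ∈ S) :
    ¬ Affects {ω : Set ι | ω ∪ S ∈ G} i := by
  rintro ⟨ω, hω, hiω⟩
  apply hω
  simp only [Set.mem_setOf_eq] at hiω ⊢
  rwa [Set.insert_union, Set.insert_eq_of_mem (Set.mem_union_right ω hi)] at hiω

/-- The forced-open hull over `esupp X ∪ esupp Y` shares no acting coordinate with `X`. [this work] -/
theorem forall_not_affects_forcedHull_left (X Y G : Set (Set ι)) :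
    ∀ i, Affects X i → Affects {ω : Set ι | ω ∪ ↑(esupp X ∪ esupp Y) ∈ G} i → False := fun _ hiX hiK =>
  not_affects_forcedHull G (mem_coe.2 (mem_union_left _ (mem_esupp.2 hiX))) hiK

/-- The forced-open hull over `esupp X ∪ esupp Y` shares no acting coordinate with `Y`. [this work] -/
theorem forall_not_affects_forcedHull_right (X Y G : Set (Set ι)) :
    ∀ i, Affects Y i → Affects {ω : Set ι | ω ∪ ↑(esupp X ∪ esupp Y) ∈ G} i → False := fun _ hiY hiK =>
  not_affects_forcedHull G (mem_coe.2 (mem_union_right _ (mem_esupp.2 hiY))) hiK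

/-- The forced-open hull over `esupp X ∪ esupp Y` shares no acting coordinate with `X ∩ Y`. [this work] -/
theorem forall_not_affects_forcedHull_inter (X Y G : Set (Set ι)) :
    ∀ i, Affects (X ∩ Y) i → Affects {ω : Set ι | ω ∪ ↑(esupp X ∪ esupp Y) ∈ G} i → False := fun i hi hiK =>
  (affects_inter_imp hi).elim (fun h => forall_not_affects_forcedHull_left X Y G i h hiK)
    fun h => forall_not_affects_forcedHull_right X Y G i h hiK

/-- **Sandwich, left**: if `(X, Y, G) ∈ Z_3` via `(X, Y)` (increasing events, `Y` nonempty) then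
`X ∩ K ⊆ G` for the forced-open hull `K = {ω | ω ∪ (esupp X ∪ esupp Y) ∈ G}`; with `G ⊆ K` this is
`X ∩ G = X ∩ K`. [this work] -/
theorem sandwich_left {X Y G : Set (Set ι)} (hX : IsUpperSet X) (hY : IsUpperSet Y) (hG : IsUpperSet G)
    (hYne : Y.Nonempty) (hZ : ZVia X Y G) :
    X ∩ G = X ∩ {ω : Set ι | ω ∪ ↑(esupp X ∪ esupp Y) ∈ G} := by
  obtain ⟨-, hXp, hYp⟩ := zVia_pivotal hX hY hG hZ
  ext ω
  simp only [Set.mem_inter_iff, Set.mem_setOf_eq, coe_union]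
  constructor
  · rintro ⟨hωX, hωG⟩
    exact ⟨hωX, hG Set.subset_union_left hωG⟩
  · rintro ⟨hωX, hωK⟩
    refine ⟨hωX, ?_⟩
    -- open `esupp Y` first: `ω₁ = ω ∪ esupp Y ∈ X ∩ Y`, and `ω₁ ∪ esupp X ∈ G`
    have hω₁X : ω ∪ ↑(esupp Y) ∈ X := hX Set.subset_union_left hωX
    have hω₁Y : ω ∪ ↑(esupp Y) ∈ Y := mem_of_esupp_subset hY hYne Set.subset_union_right
    have hω₁G : ω ∪ ↑(esupp Y) ∈ G := by
      by_contra h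
      have := union_notMem_of_forall_insert hY (esupp X) hYp _ hω₁Y h
      apply this
      rwa [Set.union_assoc, Set.union_comm (↑(esupp Y) : Set ι)]
    by_contra h
    exact union_notMem_of_forall_insert hX (esupp Y) hXp ω hωX h hω₁G

/-- **Sandwich, right**: symmetrically `Y ∩ G = Y ∩ K` (`X` nonempty). [this work] -/
theorem sandwich_right {X Y G : Set (Set ι)} (hX : IsUpperSet X) (hY : IsUpperSet Y) (hG : IsUpperSet G)
    (hXne : X.Nonempty) (hZ : ZVia X Y G) :
    Y ∩ G = Y ∩ {ω : Set ι | ω ∪ ↑(esupp X ∪ esupp Y) ∈ G} := by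
  have h := sandwich_left hY hX hG hXne (zVia_symm hZ)
  rwa [union_comm] at h

end Sandwich

end Summit.CriticalPhenomena.PercolationContinuityZ3.Theorems
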